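import Literature.Topology.PlanarFoliations.WalkWinding
import Literature.Topology.PlanarFoliations.PolygonLoop
import HarnessLib

/-!
# Pieces of the planar trace of a walk; reading a path as a chart segment

Topic: Topology / PlanarFoliations, sequel to `WalkPlaneBand.lean` (the planar trace
`walkPlaneBase` of a walk, assembled by `transFun`) and `WalkWinding.lean`. Two tools for the
winding argument on a hugged closed walk (`TraceStraight.lean`):

* **Where the pieces of the trace sit.** The last link of `walkPlaneBase J ℓ (n + 1)` occupies the
  parameters `θ ∈ [5/8, 3/4]`, read affinely (`walkPlaneBase_succ_apply_of_mem`); outside the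
  open interval `(5/8, 3/4)` the values are values of the previous trace, of the last gate, or the
  two ends of the last link (`walkPlaneBase_succ_mem_of_not_mem`); the values of a trace are its
  start point, gate points or link points (`walkPlaneBase_mem`), and gate points are the puncture or
  prong points `pt j (b, 0)`, `b ∈ (0, β]` (`gatePlaneBase_cases`).
* **Reading a monotone plaque arc as a straight chart segment.** A continuous function strictly
  monotone (increasing or decreasing) on `[w₁, w₂]` agrees there with a homeomorphism of `ℝ`
  (`exists_homeomorph_eqOn`); precomposing the first coordinate of a chart onto the plane with it
  gives a chart onto the plane (`reparamChart`) in which the arc is read as the horizontal segment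
  over `[w₁, w₂]` (`reparamChart_symm_apply`).

All statements are [folklore].
-/

noncomputable section

open Set Filter Function Metric unitInterval
open _root_.Topology
open Literature.Topology.FourManifolds Literature.Topology.FourManifolds.Foliation Literature.Topology.PlaneTopology

namespace Literature.Topology.PlanarFoliations

/-! ## Values of the level-free concatenation -/

section TransFun

variable {Y : Type*} {f f' : I → Y}

/-- On the first half the concatenation is the first map, read at `2θ`. [folklore] -/
theorem transFun_apply_left {θ : I} (h : (θ : ℝ) ≤ 1 / 2) (φ : I) (hφ : (φ : ℝ) = 2 * θ) : transFun f f' θ = f φ := by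
  rw [transFun_apply_of_le h]
  congr 1
  exact Subtype.ext ((coe_fstHalf h).trans hφ.symm)

/-- On the second half the concatenation is the second map, read at `2θ - 1`. [folklore] -/
theorem transFun_apply_right {θ : I} (h : 1 / 2 < (θ : ℝ)) (φ : I) (hφ : (φ : ℝ) = 2 * θ - 1) : transFun f f' θ = f' φ := by
  rw [transFun_apply_of_lt h]
  congr 1
  exact Subtype.ext ((coe_sndHalf h.le).trans hφ.symm)

/-- At the midpoint the concatenation is also the second map at `0`, if the maps agree there.
[folklore] -/
theorem transFun_apply_right' (hmeet : f 1 = f' 0) {θ : I} (h : 1 / 2 ≤ (θ : ℝ)) (φ : I) (hφ : (φ : ℝ) = 2 * θ - 1) :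
    transFun f f' θ = f' φ := by
  rcases h.eq_or_lt with h' | h'
  · have hθ : (θ : ℝ) ≤ 1 / 2 := h'.symm.le
    have h1 : transFun f f' θ = f 1 := transFun_apply_left hθ 1 (by rw [← h']; norm_num)
    have h0 : φ = 0 := Subtype.ext (by rw [hφ, ← h']; norm_num)
    rw [h1, h0, hmeet]
  · exact transFun_apply_right h' φ hφ

end TransFun

variable {X : Type*} [TopologicalSpace X] [Nonempty X] {F : Foliation ℝ X} {ι : X → ℂ}
variable {B : Type*} [NormedAddCommGroup B] {M : Type*} [TopologicalSpace M] {T : Foliation B M} {g : ℂ → M}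

namespace StarData

variable {D : StarData F ι T g} {hι : IsOpenEmbedding ι} {J : ℕ → D.WalkJunction hι}
  {ℓ : ∀ k, Path (J k).Kout.base (J (k + 1)).Kin.base}

/-! ## The last link inside the trace -/

/-- The parameter of the last link at the trace parameter `θ ∈ [5/8, 3/4]`: `8θ - 5`. [folklore] -/
def linkParam (θ : I) (h : (θ : ℝ) ∈ Icc (5 / 8 : ℝ) (3 / 4)) : I := ⟨8 * θ - 5, by constructor <;> linarith [h.1, h.2]⟩

omit [Nonempty X] in
/-- The value of the link parameter. [folklore] -/
@[simp] theorem coe_linkParam (θ : I) (h : (θ : ℝ) ∈ Icc (5 / 8 : ℝ) (3 / 4)) : (linkParam θ h : ℝ) = 8 * θ - 5 := rfl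

/-- **The last link of the trace occupies `[5/8, 3/4]`, affinely.** [folklore] -/
theorem walkPlaneBase_succ_apply_of_mem (n : ℕ) {θ : I} (h : (θ : ℝ) ∈ Icc (5 / 8 : ℝ) (3 / 4)) :
    walkPlaneBase J ℓ (n + 1) θ = ι (ℓ n (linkParam θ h)) := by
  show transFun _ (fun θ ↦ ι (transFun (transFun (fun _ ↦ (J n).Kout.base) (ℓ n)) (fun _ ↦ (J (n + 1)).Kin.base) θ)) θ = _
  have hθ : 1 / 2 < (θ : ℝ) := by linarith [h.1]
  set u : I := ⟨2 * θ - 1, by constructor <;> linarith [h.1, h.2]⟩ with hu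
  rw [transFun_apply_right hθ u rfl]
  show ι (transFun (transFun (fun _ ↦ (J n).Kout.base) (ℓ n)) (fun _ ↦ (J (n + 1)).Kin.base) u) = _
  congr 1
  have hu' : (u : ℝ) ≤ 1 / 2 := by show 2 * (θ : ℝ) - 1 ≤ 1 / 2; linarith [h.2]
  set v : I := ⟨4 * θ - 2, by constructor <;> linarith [h.1, h.2]⟩ with hv
  rw [transFun_apply_left hu' v (by show (4 * θ - 2 : ℝ) = 2 * (2 * θ - 1); ring)]
  have hv' : 1 / 2 ≤ (v : ℝ) := by show (1 / 2 : ℝ) ≤ 4 * θ - 2; linarith [h.1]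
  exact transFun_apply_right' (ℓ n).source.symm hv' _ (by show (8 * θ - 5 : ℝ) = 2 * (4 * θ - 2) - 1; ring)

/-- **Outside `(5/8, 3/4)` the values of the trace are values of the previous trace, of the last
gate, or the ends of the last link.** [folklore] -/
theorem walkPlaneBase_succ_mem_of_not_mem (n : ℕ) {θ : I} (h : (θ : ℝ) ∉ Ioo (5 / 8 : ℝ) (3 / 4)) :
    walkPlaneBase J ℓ (n + 1) θ ∈ range (walkPlaneBase J ℓ n) ∪
      range (D.gatePlaneBase (J n).hv (J n).jin (J n).jout (J n).β) ∪ {ι ((J n).Kout.base), ι ((J (n + 1)).Kin.base)} := by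
  by_cases hθ : (θ : ℝ) ≤ 1 / 2
  · left
    show transFun (transFun (walkPlaneBase J ℓ n) _) _ θ ∈ _
    rw [transFun_apply_of_le hθ]
    exact range_transFun_subset ⟨_, rfl⟩
  · right
    push Not at hθ
    show transFun _ (fun θ ↦ ι (transFun (transFun (fun _ ↦ (J n).Kout.base) (ℓ n)) (fun _ ↦ (J (n + 1)).Kin.base) θ)) θ ∈ _
    rw [transFun_apply_of_lt hθ]
    set u := sndHalf θ with hu
    have hcu : (u : ℝ) = 2 * θ - 1 := coe_sndHalf hθ.le
    show ι (transFun (transFun (fun _ ↦ (J n).Kout.base) (ℓ n)) (fun _ ↦ (J (n + 1)).Kin.base) u) ∈ _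
    by_cases hu2 : (u : ℝ) ≤ 1 / 2
    · rw [transFun_apply_of_le hu2]
      set v := fstHalf u with hv
      have hcv : (v : ℝ) = 2 * u := coe_fstHalf hu2
      by_cases hθ' : (θ : ℝ) ≤ 5 / 8
      · -- the constant at `Kout.base`
        have hv2 : (v : ℝ) ≤ 1 / 2 := by rw [hcv, hcu]; linarith
        rw [transFun_apply_of_le hv2]
        exact Or.inl rfl
      · -- `θ = 3/4`: the end of the link
        have hθ34 : (θ : ℝ) = 3 / 4 := by
          by_contra hne
          have : (θ : ℝ) ≤ 3 / 4 := by rw [hcu] at hu2; linarith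
          exact h ⟨not_le.1 hθ', lt_of_le_of_ne this hne⟩
        have hv1 : v = 1 := Subtype.ext (by rw [hcv, hcu, hθ34]; norm_num)
        have hv2 : ¬ ((v : ℝ) ≤ 1 / 2) := by rw [hv1]; norm_num
        rw [transFun_apply_of_lt (not_le.1 hv2), hv1, sndHalf_one, (ℓ n).target]
        exact Or.inr rfl
    · rw [transFun_apply_of_lt (not_le.1 hu2)]
      exact Or.inr rfl

/-- **The values of the trace**: the start point, gate points or link points. [folklore] -/
theorem walkPlaneBase_mem (n : ℕ) (θ : I) :
    walkPlaneBase J ℓ n θ = (D.star (J 0).v (J 0).hv).pt (J 0).jin ((J 0).β, 0) ∨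
      ∃ k < n, walkPlaneBase J ℓ n θ ∈ range (D.gatePlaneBase (J k).hv (J k).jin (J k).jout (J k).β) ∪ ι '' range (ℓ k) := by
  induction n generalizing θ with
  | zero => exact Or.inl rfl
  | succ n ih =>
    have hmem : walkPlaneBase J ℓ (n + 1) θ ∈ range (walkPlaneBase J ℓ n) ∪
        range (D.gatePlaneBase (J n).hv (J n).jin (J n).jout (J n).β) ∪ ι '' range (ℓ n) := by
      show transFun (transFun (walkPlaneBase J ℓ n) _)
        (fun θ ↦ ι (transFun (transFun (fun _ ↦ (J n).Kout.base) (ℓ n)) (fun _ ↦ (J (n + 1)).Kin.base) θ)) θ ∈ _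
      rcases range_transFun_subset ⟨θ, rfl⟩ with h | ⟨φ, hφ⟩
      · exact Or.inl (range_transFun_subset h)
      · right
        rw [← hφ]
        refine ⟨_, ?_, rfl⟩
        rcases range_transFun_subset (f := transFun (fun _ ↦ (J n).Kout.base) (ℓ n)) (f' := fun _ ↦ (J (n + 1)).Kin.base) ⟨φ, rfl⟩
          with h' | ⟨_, h'⟩
        · rcases range_transFun_subset h' with ⟨_, h''⟩ | h''
          · rw [← h'']; exact ⟨0, (ℓ n).source⟩
          · exact h''
        · rw [← h']; exact ⟨1, (ℓ n).target⟩
    rcases hmem with (⟨θ', hθ'⟩ | h) | h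
    · rcases ih θ' with h0 | ⟨k, hk, hk'⟩
      · left; rw [← hθ', h0]
      · right; exact ⟨k, Nat.lt_succ_of_lt hk, hθ' ▸ hk'⟩
    · exact Or.inr ⟨n, n.lt_succ_self, Or.inl h⟩
    · exact Or.inr ⟨n, n.lt_succ_self, Or.inr h⟩

omit [Nonempty X] in
/-- **The values of a gate**: the puncture, or prong points of the incoming or of the outgoing
prong with parameter in `(0, β]`. [folklore] -/
theorem gatePlaneBase_cases {v : ℂ} (hv : D.nprong v ≠ 0) (j j' : ZMod (D.nprong v)) {β : ℝ} (hβ : 0 ≤ β) (θ : I) :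
    D.gatePlaneBase hv j j' β θ = v ∨ (∃ b ∈ Ioc 0 β, D.gatePlaneBase hv j j' β θ = (D.star v hv).pt j (b, 0)) ∨
      ∃ b ∈ Ioc 0 β, D.gatePlaneBase hv j j' β θ = (D.star v hv).pt j' (b, 0) := by
  have key : ∀ (j₀ : ZMod (D.nprong v)) (b : ℝ), b ∈ Icc 0 β → (D.star v hv).pt j₀ (b, 0) = v ∨
      ∃ b' ∈ Ioc 0 β, (D.star v hv).pt j₀ (b, 0) = (D.star v hv).pt j₀ (b', 0) := by
    intro j₀ b hb
    rcases hb.1.eq_or_lt with h0 | h0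
    · left; rw [← h0, Prod.mk_zero_zero, ProngStar.pt_zero]
    · exact Or.inr ⟨b, ⟨h0, hb.2⟩, rfl⟩
  unfold gatePlaneBase
  rcases range_transFun_subset (f := transFun (fun θ ↦ (D.star v hv).pt j (βline β 0 θ, 0)) (fun _ ↦ v))
      (f' := fun θ ↦ (D.star v hv).pt j' (βline 0 β θ, 0)) ⟨θ, rfl⟩ with h | ⟨φ, hφ⟩
  · rcases range_transFun_subset h with ⟨φ, hφ⟩ | ⟨_, hφ⟩
    · rw [← hφ]
      rcases key j (βline β 0 φ) (βline_mem ⟨hβ, le_rfl⟩ ⟨le_rfl, hβ⟩ φ) with h' | h'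
      · exact Or.inl h'
      · exact Or.inr (Or.inl h')
    · exact Or.inl hφ.symm
  · rw [← hφ]
    rcases key j' (βline 0 β φ) (βline_mem ⟨le_rfl, hβ⟩ ⟨hβ, le_rfl⟩ φ) with h' | h'
    · exact Or.inl h'
    · exact Or.inr (Or.inr h')

end StarData

/-! ## Extending a monotone function on an interval to a homeomorphism of the line -/

section Extend

variable {A : ℝ → ℝ} {w₁ w₂ : ℝ}

/-- The piecewise extension of `A` from `[w₁, w₂]` by translations. [folklore] -/
def extendMono (A : ℝ → ℝ) (w₁ w₂ : ℝ) (w : ℝ) : ℝ :=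
  if w ≤ w₁ then A w₁ + (w - w₁) else if w ≤ w₂ then A w else A w₂ + (w - w₂)

/-- The extension agrees with `A` on `[w₁, w₂]`. [folklore] -/
theorem extendMono_eqOn : EqOn (extendMono A w₁ w₂) A (Icc w₁ w₂) := by
  intro w hw
  unfold extendMono
  split_ifs with h₁ h₂
  · rw [le_antisymm h₁ hw.1, sub_self, add_zero]
  · rfl
  · exact absurd hw.2 h₂

/-- **The extension of a strictly increasing function is strictly increasing.** [folklore] -/
theorem strictMono_extendMono (h : w₁ ≤ w₂) (hA : StrictMonoOn A (Icc w₁ w₂)) : StrictMono (extendMono A w₁ w₂) := by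
  have hmono : MonotoneOn A (Icc w₁ w₂) := hA.monotoneOn
  intro a b hab
  show extendMono A w₁ w₂ a < extendMono A w₁ w₂ b
  unfold extendMono
  by_cases ha₁ : a ≤ w₁
  · rw [if_pos ha₁]
    by_cases hb₁ : b ≤ w₁
    · rw [if_pos hb₁]; linarith
    · rw [if_neg hb₁]
      by_cases hb₂ : b ≤ w₂
      · rw [if_pos hb₂]
        have : A w₁ < A b := hA ⟨le_rfl, h⟩ ⟨(not_le.1 hb₁).le, hb₂⟩ (not_le.1 hb₁)
        linarith
      · rw [if_neg hb₂]
        have : A w₁ ≤ A w₂ := hmono ⟨le_rfl, h⟩ ⟨h, le_rfl⟩ h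
        push Not at hb₂; linarith
  · rw [if_neg ha₁]
    have hb₁ : ¬ b ≤ w₁ := fun hb ↦ ha₁ (hab.le.trans hb)
    rw [if_neg hb₁]
    by_cases ha₂ : a ≤ w₂
    · rw [if_pos ha₂]
      by_cases hb₂ : b ≤ w₂
      · rw [if_pos hb₂]; exact hA ⟨(not_le.1 ha₁).le, ha₂⟩ ⟨(not_le.1 hb₁).le, hb₂⟩ hab
      · rw [if_neg hb₂]
        have : A a ≤ A w₂ := hmono ⟨(not_le.1 ha₁).le, ha₂⟩ ⟨h, le_rfl⟩ ha₂
        push Not at hb₂; linarith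
    · rw [if_neg ha₂]
      have hb₂ : ¬ b ≤ w₂ := fun hb ↦ ha₂ (hab.le.trans hb)
      rw [if_neg hb₂]; linarith

/-- The extension is onto. [folklore] -/
theorem surjective_extendMono (h : w₁ ≤ w₂) (hc : ContinuousOn A (Icc w₁ w₂)) :
    Surjective (extendMono A w₁ w₂) := by
  intro y
  by_cases hy₁ : y ≤ A w₁
  · refine ⟨w₁ - (A w₁ - y), ?_⟩
    unfold extendMono
    rw [if_pos (by linarith)]; ring
  · by_cases hy₂ : y ≤ A w₂
    · -- intermediate value on `[w₁, w₂]`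
      have hy : y ∈ Icc (A w₁) (A w₂) := ⟨(not_le.1 hy₁).le, hy₂⟩
      obtain ⟨w, hw, hAw⟩ := intermediate_value_Icc h hc hy
      exact ⟨w, (extendMono_eqOn hw).trans hAw⟩
    · refine ⟨w₂ + (y - A w₂), ?_⟩
      have h2 : ¬ w₂ + (y - A w₂) ≤ w₂ := by push Not at hy₂ ⊢; linarith
      have h1 : ¬ w₂ + (y - A w₂) ≤ w₁ := fun h' ↦ h2 (h'.trans h)
      unfold extendMono
      rw [if_neg h1, if_neg h2]; ring

/-- **A continuous function strictly monotone on `[w₁, w₂]` agrees there with a homeomorphism of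
the line**, which maps `(w₁, w₂)` onto the open interval between the end values. [folklore] -/
theorem exists_homeomorph_eqOn (h : w₁ < w₂) (hc : ContinuousOn A (Icc w₁ w₂))
    (hA : StrictMonoOn A (Icc w₁ w₂) ∨ StrictAntiOn A (Icc w₁ w₂)) :
    ∃ φ : ℝ ≃ₜ ℝ, EqOn φ A (Icc w₁ w₂) ∧ φ '' Ioo w₁ w₂ = Ioo (min (A w₁) (A w₂)) (max (A w₁) (A w₂)) := by
  -- the increasing case
  have mono : ∀ {A : ℝ → ℝ}, ContinuousOn A (Icc w₁ w₂) → StrictMonoOn A (Icc w₁ w₂) →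
      ∃ φ : ℝ ≃ₜ ℝ, EqOn φ A (Icc w₁ w₂) ∧ φ '' Ioo w₁ w₂ = Ioo (A w₁) (A w₂) := by
    intro A hc hA
    set ψ := (strictMono_extendMono h.le hA).orderIsoOfSurjective _ (surjective_extendMono h.le hc) with hψ
    refine ⟨ψ.toHomeomorph, fun w hw ↦ extendMono_eqOn hw, ?_⟩
    have hψA : ∀ w ∈ Icc w₁ w₂, ψ.toHomeomorph w = A w := fun w hw ↦ extendMono_eqOn hw
    ext y
    constructor
    · rintro ⟨w, hw, rfl⟩
      rw [← hψA w₁ ⟨le_rfl, h.le⟩, ← hψA w₂ ⟨h.le, le_rfl⟩]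
      exact ⟨ψ.strictMono hw.1, ψ.strictMono hw.2⟩
    · intro hy
      refine ⟨ψ.symm y, ⟨?_, ?_⟩, ψ.apply_symm_apply y⟩
      · have : ψ w₁ < ψ (ψ.symm y) := by rw [ψ.apply_symm_apply]; exact (hψA w₁ ⟨le_rfl, h.le⟩).symm ▸ hy.1
        exact ψ.lt_iff_lt.1 this
      · have : ψ (ψ.symm y) < ψ w₂ := by rw [ψ.apply_symm_apply]; exact (hψA w₂ ⟨h.le, le_rfl⟩).symm ▸ hy.2
        exact ψ.lt_iff_lt.1 this
  rcases hA with hA | hA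
  · obtain ⟨φ, hφ, himg⟩ := mono hc hA
    have h12 : A w₁ < A w₂ := hA ⟨le_rfl, h.le⟩ ⟨h.le, le_rfl⟩ h
    exact ⟨φ, hφ, by rw [himg, min_eq_left h12.le, max_eq_right h12.le]⟩
  · -- the decreasing case: extend `-A` and negate
    obtain ⟨φ, hφ, himg⟩ := mono (A := fun w ↦ -A w) hc.neg hA.neg
    have h12 : A w₂ < A w₁ := hA ⟨le_rfl, h.le⟩ ⟨h.le, le_rfl⟩ h
    refine ⟨φ.trans (Homeomorph.neg ℝ), fun w hw ↦ ?_, ?_⟩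
    · show -(φ w) = A w
      rw [hφ hw, neg_neg]
    · rw [min_eq_right h12.le, max_eq_left h12.le]
      show (fun w ↦ -(φ w)) '' Ioo w₁ w₂ = Ioo (A w₂) (A w₁)
      ext y
      constructor
      · rintro ⟨w, hw, rfl⟩
        have : φ w ∈ Ioo (-A w₁) (-A w₂) := by rw [← himg]; exact ⟨w, hw, rfl⟩
        exact ⟨by linarith [this.2], by linarith [this.1]⟩
      · intro hy
        have : -y ∈ φ '' Ioo w₁ w₂ := by rw [himg]; exact ⟨by linarith [hy.2], by linarith [hy.1]⟩
        obtain ⟨w, hw, hwy⟩ := this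
        exact ⟨w, hw, by show -φ w = y; rw [hwy, neg_neg]⟩

end Extend

/-! ## Reading a chart with a reparametrised first coordinate -/

section Reparam

/-- The homeomorphism of the plane reparametrising the first coordinate by `φ⁻¹`. [folklore] -/
def fstReparam (φ : ℝ ≃ₜ ℝ) : ℝ × ℝ ≃ₜ ℝ × ℝ := φ.symm.prodCongr (Homeomorph.refl ℝ)

/-- **The chart with first coordinate reparametrised**: `x ↦ (φ⁻¹ (e x).1, (e x).2)`. [folklore] -/
def reparamChart (e : OpenPartialHomeomorph X (ℝ × ℝ)) (φ : ℝ ≃ₜ ℝ) : OpenPartialHomeomorph X (ℝ × ℝ) :=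
  e.transHomeomorph (fstReparam φ)

variable (e : OpenPartialHomeomorph X (ℝ × ℝ)) (φ : ℝ ≃ₜ ℝ)

omit [Nonempty X] in
/-- The reparametrised chart reads `(φ⁻¹ u, t)`. [folklore] -/
@[simp] theorem reparamChart_apply (x : X) : reparamChart e φ x = (φ.symm (e x).1, (e x).2) := rfl

omit [Nonempty X] in
/-- **The inverse of the reparametrised chart**: `(w, t) ↦ e⁻¹ (φ w, t)`. [folklore] -/
@[simp] theorem reparamChart_symm_apply (p : ℝ × ℝ) : (reparamChart e φ).symm p = e.symm (φ p.1, p.2) := rfl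

omit [Nonempty X] in
/-- The reparametrised chart has the same source. [folklore] -/
@[simp] theorem reparamChart_source : (reparamChart e φ).source = e.source := rfl

omit [Nonempty X] in
/-- The reparametrised chart of a chart onto the plane is onto the plane. [folklore] -/
theorem reparamChart_target (he : e.target = univ) : (reparamChart e φ).target = univ := by
  simp [reparamChart, he]

omit [Nonempty X] in
/-- **The open boxes of the reparametrised chart are open boxes of the chart.** [folklore] -/
theorem reparamChart_symm_image_box {w₁ w₂ a₁ a₂ : ℝ} (hφ : φ '' Ioo w₁ w₂ = Ioo a₁ a₂) (H : Set ℝ) :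
    (fun q : ℝ × ℝ ↦ (reparamChart e φ).symm q) '' (Ioo w₁ w₂ ×ˢ H) = (fun q : ℝ × ℝ ↦ e.symm q) '' (Ioo a₁ a₂ ×ˢ H) := by
  ext z
  simp only [mem_image, mem_prod, reparamChart_symm_apply, Prod.exists]
  constructor
  · rintro ⟨w, t, ⟨hw, ht⟩, rfl⟩
    exact ⟨φ w, t, ⟨by rw [← hφ]; exact ⟨w, hw, rfl⟩, ht⟩, rfl⟩
  · rintro ⟨a, t, ⟨ha, ht⟩, rfl⟩
    rw [← hφ] at ha
    obtain ⟨w, hw, rfl⟩ := ha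
    exact ⟨w, t, ⟨hw, ht⟩, rfl⟩

end Reparam

end Literature.Topology.PlanarFoliations
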